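import Summits.QuantumFields.BalabanUV.T4Continuum.Support.NE3SmoothLiftCurl
import Summits.QuantumFields.BalabanUV.T4Continuum.Support.NE3CoercivityScaling
import HarnessLib

/-!
# NE7CutoffSecondOrderData — supplier stub (S-d′) brick (ROAD-G107 §6 (b)): THE SECOND-ORDER LEIBNIZ DATA OF A CUT-OFF FIELD AT THE FLAT BACKGROUND —
# for `F = χ•V` (real cutoff `χ` with `|χ| ≤ 1`, unit-step differences `≤ g₁`, second differences `≤ g₂`; matrix field `V` with sup `S`, plain gradient `G`,
# flat curl `B` with adjacent differences `B′`), the adjacent differences of `curlAt 1 F` are `≤ B′ + g₁B + 2(g₂S + g₁G)` and `flatDiv F = χ·flatDiv V + R′`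
# with `‖R′(x + e_λ) − R′(x)‖ ≤ d·(g₂S + g₁G)` — exactly the data `B′`, `D′` of the flat C¹ letters `NE7FlatGradientLetterCompact.gradient_letter_cube ∕ _box`

Cell `pub-balaban`, rung (B)+1 sub-cell t4, lineage `b2b-balaban-t4-ne7-p1`, generation 107 (CRUX PROVER NE7 #1 = OWNER of BINDER row NE7).
Memo `t4/b2b-balaban-t4-ne7-p1-g107/ROAD-G107.md` §6 (the curved C¹ bootstrap with logs: gen 101's `NE7CurvedSupLetter` pattern one derivative up).
WHY.  The bootstrap cuts the gauge-transformed slice field off (`Z = χ•Y^{u}`) and feeds the flat C¹ letter, whose hypotheses are ONE LATTICE DERIVATIVE of the flat curl and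
of the flat divergence of `Z`; gen 101's `NE7CurvedSupLetterData` ∕ `NE7CutoffLeibniz.curlAt_smul_fun` are the zeroth-order Leibniz rules; THIS FILE is the first-order one.
WHAT ([folklore]; 0 def, 0 sorry; flat background, any dimension `d`, any `n`).
 * §1 `curlAt_flat_smul` — `curlAt 1 (χ•V) z μ ν = χ z • curlAt 1 V z μ ν + ((χ(z+e_μ) − χ z)•V(z+e_μ) ν − (χ(z+e_ν) − χ z)•V(z+e_ν) μ)`;
   `flatDiv_smul` — `flatDiv (χ•V) x = χ x • flatDiv V x + Σ_μ (χ x − χ(x−e_μ))•V(x−e_μ) μ`.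
 * §2 **`norm_fdiff_curlAt_flat_smul_le`** — `‖curlAt 1 F (z+e_λ) μ ν − curlAt 1 F z μ ν‖ ≤ B′ + g₁·B + 2(g₂·S + g₁·G)`.
 * §3 **`norm_fdiff_flatDivRem_le`** — `‖R′(x+e_λ) − R′(x)‖ ≤ d·(g₂·S + g₁·G)`; **`norm_fdiff_flatDiv_smul_le`** — with `flatDiv V = g + s`, `‖s‖ ≤ D`, adjacent differences of
   `s` `≤ D′`: `flatDiv F = (fun x => χ x • g x) + s_F` with `‖s_F(x+e_λ) − s_F(x)‖ ≤ g₁·D + D′ + d·(g₂·S + g₁·G)` (the block-constant part `χ•g` goes to the log letter (S-c‴)(iii)).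
HYPOTHESIS SHAPES: `∀ x i, |χ (x + e i) − χ x| ≤ g₁`; `∀ x i j, |χ (x + e i + e j) − χ (x + e i) − χ (x + e j) + χ x| ≤ g₂` (pure and mixed second differences);
`∀ x κ, ‖V x κ‖ ≤ S`; `∀ x λ κ, ‖V (x + e λ) κ − V x κ‖ ≤ G`.
HONEST FRAMING (page 1): flat lattice Leibniz algebra on OUR objects; the C^{1,1} cutoff itself (second differences `O((MK_b)⁻²)` — the `ℓ^∞`-box cutoff `chi` is only Lipschitz) is a
separate brick; nothing of Bałaban's asserted; nothing of NE3∕NE7 discharged; spine count = dagwriter∕referees' call; FIXED FINITE T⁴, rung (B)+1 — NOT infinite volume, NOT mass gap,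
NOT BetaPertH, NOT Clay.
-/

set_option autoImplicit false

open scoped BigOperators Matrix.Norms.L2Operator
open Finset

namespace Summit.QuantumFields.BalabanUV.T4Continuum.NE7CutoffSecondOrderData

open Literature.MathematicalPhysics.QuantumFieldTheory.Balaban1983to89
open B7Prop1Explicit (Site e)
open T4AveragingDeficitWall (curlAt)
open BlockAveragePushDirSplit (flat)
open NE3CoercivityScaling (flatDiv)
open NE3SmoothLiftCurl (curlAt_flat_eq)

noncomputable section

variable {d : ℕ} {n : Type*} [Fintype n] [DecidableEq n]

/-! ## §1 The Leibniz identities at the flat background -/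

/-- **LEIBNIZ FOR THE FLAT CURL**: `curlAt 1 (χ•V) z μ ν = χ z • curlAt 1 V z μ ν + ((χ(z+e_μ) − χ z)•V(z+e_μ) ν − (χ(z+e_ν) − χ z)•V(z+e_ν) μ)`. [folklore] -/
theorem curlAt_flat_smul (χ : Site d → ℝ) (V : Site d → Fin d → Matrix n n ℂ) (z : Site d) (μ ν : Fin d) :
    curlAt (flat (d := d) (n := n)) (fun w κ => χ w • V w κ) z μ ν
      = χ z • curlAt (flat (d := d) (n := n)) V z μ ν
        + ((χ (z + e μ) - χ z) • V (z + e μ) ν - (χ (z + e ν) - χ z) • V (z + e ν) μ) := by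
  rw [curlAt_flat_eq, curlAt_flat_eq]
  simp only [sub_smul, smul_sub]
  abel

omit [Fintype n] [DecidableEq n] in
/-- **LEIBNIZ FOR THE FLAT DIVERGENCE**: `flatDiv (χ•V) x = χ x • flatDiv V x + Σ_μ (χ x − χ(x−e_μ))•V(x−e_μ) μ`. [folklore] -/
theorem flatDiv_smul (χ : Site d → ℝ) (V : Site d → Fin d → Matrix n n ℂ) (x : Site d) :
    flatDiv (fun w κ => χ w • V w κ) x = χ x • flatDiv V x + ∑ μ : Fin d, (χ x - χ (x - e μ)) • V (x - e μ) μ := by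
  unfold flatDiv
  rw [smul_sum, ← sum_add_distrib]
  refine sum_congr rfl fun μ _ => ?_
  simp only [sub_smul, smul_sub]
  abel

/-! ## §2 One lattice derivative of the flat curl of the cut-off field -/

/-- **THE CURL DATUM `B′` OF THE CUT-OFF FIELD**: with `|χ| ≤ 1`, unit-step differences of `χ` `≤ g₁`, second differences `≤ g₂`, `‖V‖ ≤ S`, plain gradient `‖V(x+e_λ) κ − V x κ‖ ≤ G`,
`‖curlAt 1 V‖ ≤ B` and `‖curlAt 1 V (z+e_λ) − curlAt 1 V z‖ ≤ B′`:
`‖curlAt 1 (χ•V) (z+e_λ) μ ν − curlAt 1 (χ•V) z μ ν‖ ≤ B′ + g₁·B + 2(g₂·S + g₁·G)`. [folklore] -/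
theorem norm_fdiff_curlAt_flat_smul_le (χ : Site d → ℝ) (V : Site d → Fin d → Matrix n n ℂ) {g₁ g₂ S G B B' : ℝ}
    (hχ1 : ∀ x, |χ x| ≤ 1) (hg₁ : ∀ (x : Site d) (i : Fin d), |χ (x + e i) - χ x| ≤ g₁)
    (hg₂ : ∀ (x : Site d) (i j : Fin d), |χ (x + e i + e j) - χ (x + e i) - χ (x + e j) + χ x| ≤ g₂)
    (hS : ∀ x κ, ‖V x κ‖ ≤ S) (hG : ∀ (x : Site d) (lam κ : Fin d), ‖V (x + e lam) κ - V x κ‖ ≤ G)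
    (hB : ∀ (z : Site d) (μ ν : Fin d), ‖curlAt (flat (d := d) (n := n)) V z μ ν‖ ≤ B)
    (hB' : ∀ (z : Site d) (lam μ ν : Fin d), ‖curlAt (flat (d := d) (n := n)) V (z + e lam) μ ν - curlAt (flat (d := d) (n := n)) V z μ ν‖ ≤ B')
    (z : Site d) (lam μ ν : Fin d) :
    ‖curlAt (flat (d := d) (n := n)) (fun w κ => χ w • V w κ) (z + e lam) μ ν - curlAt (flat (d := d) (n := n)) (fun w κ => χ w • V w κ) z μ ν‖
      ≤ B' + g₁ * B + 2 * (g₂ * S + g₁ * G) := by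
  have hg₁0 : 0 ≤ g₁ := (abs_nonneg _).trans (hg₁ z μ)
  have hS0 : 0 ≤ S := (norm_nonneg _).trans (hS z μ)
  rw [curlAt_flat_smul, curlAt_flat_smul]
  set c' := curlAt (flat (d := d) (n := n)) V (z + e lam) μ ν with hc'
  set c := curlAt (flat (d := d) (n := n)) V z μ ν with hc
  -- the main part `χ(z+e_λ)•c′ − χ z•c = χ(z+e_λ)•(c′ − c) + (χ(z+e_λ) − χ z)•c`
  have hmain : ‖χ (z + e lam) • c' - χ z • c‖ ≤ B' + g₁ * B := by
    have e1 : χ (z + e lam) • c' - χ z • c = χ (z + e lam) • (c' - c) + (χ (z + e lam) - χ z) • c := by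
      simp only [smul_sub, sub_smul]; abel
    rw [e1]
    calc _ ≤ ‖χ (z + e lam) • (c' - c)‖ + ‖(χ (z + e lam) - χ z) • c‖ := norm_add_le _ _
      _ ≤ 1 * B' + g₁ * B := by
          rw [norm_smul, norm_smul, Real.norm_eq_abs, Real.norm_eq_abs]
          exact add_le_add (mul_le_mul (hχ1 _) (hB' z lam μ ν) (norm_nonneg _) zero_le_one)
            (mul_le_mul (hg₁ z lam) (hB z μ ν) (norm_nonneg _) hg₁0)
      _ = B' + g₁ * B := by ring
  -- one remainder term: `a(z)•V(z+e_μ) ν` with `a(z) = χ(z+e_μ) − χ z`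
  have hrem : ∀ (α β : Fin d), ‖(χ (z + e lam + e α) - χ (z + e lam)) • V (z + e lam + e α) β - (χ (z + e α) - χ z) • V (z + e α) β‖ ≤ g₂ * S + g₁ * G := by
    intro α β
    have e1 : (χ (z + e lam + e α) - χ (z + e lam)) • V (z + e lam + e α) β - (χ (z + e α) - χ z) • V (z + e α) β
        = (χ (z + e lam + e α) - χ (z + e lam) - χ (z + e α) + χ z) • V (z + e lam + e α) β
          + (χ (z + e α) - χ z) • (V (z + e lam + e α) β - V (z + e α) β) := by
      simp only [sub_smul, smul_sub, add_smul]; abel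
    rw [e1]
    have h2 : |χ (z + e lam + e α) - χ (z + e lam) - χ (z + e α) + χ z| ≤ g₂ := hg₂ z lam α
    have h3 : ‖V (z + e lam + e α) β - V (z + e α) β‖ ≤ G := by
      have := hG (z + e α) lam β; rwa [show z + e α + e lam = z + e lam + e α by abel] at this
    calc _ ≤ ‖(χ (z + e lam + e α) - χ (z + e lam) - χ (z + e α) + χ z) • V (z + e lam + e α) β‖
          + ‖(χ (z + e α) - χ z) • (V (z + e lam + e α) β - V (z + e α) β)‖ := norm_add_le _ _
      _ ≤ g₂ * S + g₁ * G := by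
          rw [norm_smul, norm_smul, Real.norm_eq_abs, Real.norm_eq_abs]
          exact add_le_add (mul_le_mul h2 (hS _ _) (norm_nonneg _) ((abs_nonneg _).trans h2))
            (mul_le_mul (hg₁ z α) h3 (norm_nonneg _) hg₁0)
  have hμ := hrem μ ν
  have hν := hrem ν μ
  -- assemble
  calc ‖χ (z + e lam) • c' + ((χ (z + e lam + e μ) - χ (z + e lam)) • V (z + e lam + e μ) ν - (χ (z + e lam + e ν) - χ (z + e lam)) • V (z + e lam + e ν) μ)
        - (χ z • c + ((χ (z + e μ) - χ z) • V (z + e μ) ν - (χ (z + e ν) - χ z) • V (z + e ν) μ))‖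
      = ‖(χ (z + e lam) • c' - χ z • c)
          + (((χ (z + e lam + e μ) - χ (z + e lam)) • V (z + e lam + e μ) ν - (χ (z + e μ) - χ z) • V (z + e μ) ν)
            - ((χ (z + e lam + e ν) - χ (z + e lam)) • V (z + e lam + e ν) μ - (χ (z + e ν) - χ z) • V (z + e ν) μ))‖ := by
        congr 1; abel
    _ ≤ ‖χ (z + e lam) • c' - χ z • c‖
          + (‖(χ (z + e lam + e μ) - χ (z + e lam)) • V (z + e lam + e μ) ν - (χ (z + e μ) - χ z) • V (z + e μ) ν‖
            + ‖(χ (z + e lam + e ν) - χ (z + e lam)) • V (z + e lam + e ν) μ - (χ (z + e ν) - χ z) • V (z + e ν) μ‖) :=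
        (norm_add_le _ _).trans (add_le_add le_rfl (norm_sub_le _ _))
    _ ≤ (B' + g₁ * B) + ((g₂ * S + g₁ * G) + (g₂ * S + g₁ * G)) := add_le_add hmain (add_le_add hμ hν)
    _ = B' + g₁ * B + 2 * (g₂ * S + g₁ * G) := by ring

/-! ## §3 One lattice derivative of the flat divergence of the cut-off field -/

/-- **THE DIVERGENCE REMAINDER IS LIPSCHITZ**: `R′(x) := Σ_μ (χ x − χ(x−e_μ))•V(x−e_μ) μ` has `‖R′(x+e_λ) − R′(x)‖ ≤ d·(g₂·S + g₁·G)`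
(second differences of `χ` based at `x − e_μ`, plain gradient of `V` at `x − e_μ`). [folklore] -/
theorem norm_fdiff_flatDivRem_le (χ : Site d → ℝ) (V : Site d → Fin d → Matrix n n ℂ) {g₁ g₂ S G : ℝ}
    (hg₁ : ∀ (x : Site d) (i : Fin d), |χ (x + e i) - χ x| ≤ g₁)
    (hg₂ : ∀ (x : Site d) (i j : Fin d), |χ (x + e i + e j) - χ (x + e i) - χ (x + e j) + χ x| ≤ g₂)
    (hS : ∀ x κ, ‖V x κ‖ ≤ S) (hG : ∀ (x : Site d) (lam κ : Fin d), ‖V (x + e lam) κ - V x κ‖ ≤ G) (x : Site d) (lam : Fin d) :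
    ‖(∑ μ : Fin d, (χ (x + e lam) - χ (x + e lam - e μ)) • V (x + e lam - e μ) μ) - ∑ μ : Fin d, (χ x - χ (x - e μ)) • V (x - e μ) μ‖
      ≤ d * (g₂ * S + g₁ * G) := by
  rw [← sum_sub_distrib]
  have hterm : ∀ μ ∈ (univ : Finset (Fin d)),
      ‖(χ (x + e lam) - χ (x + e lam - e μ)) • V (x + e lam - e μ) μ - (χ x - χ (x - e μ)) • V (x - e μ) μ‖ ≤ g₂ * S + g₁ * G := by
    intro μ _
    -- base point `y = x − e_μ`: `x = y + e_μ`, `x + e_λ − e_μ = y + e_λ`, `x + e_λ = y + e_λ + e_μ`... with steps `e_μ`, `e_λ`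
    set y : Site d := x - e μ with hy
    have ex : x = y + e μ := by rw [hy, sub_add_cancel]
    have e1 : x + e lam - e μ = y + e lam := by rw [ex]; abel
    have e2 : x + e lam = y + e lam + e μ := by rw [ex]; abel
    rw [e1, e2, ex]
    have hg₁0 : 0 ≤ g₁ := (abs_nonneg _).trans (hg₁ y μ)
    have esplit : (χ (y + e lam + e μ) - χ (y + e lam)) • V (y + e lam) μ - (χ (y + e μ) - χ y) • V y μ
        = (χ (y + e lam + e μ) - χ (y + e lam) - χ (y + e μ) + χ y) • V (y + e lam) μ + (χ (y + e μ) - χ y) • (V (y + e lam) μ - V y μ) := by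
      simp only [sub_smul, smul_sub, add_smul]; abel
    rw [esplit]
    have h2 : |χ (y + e lam + e μ) - χ (y + e lam) - χ (y + e μ) + χ y| ≤ g₂ := hg₂ y lam μ
    calc _ ≤ ‖(χ (y + e lam + e μ) - χ (y + e lam) - χ (y + e μ) + χ y) • V (y + e lam) μ‖ + ‖(χ (y + e μ) - χ y) • (V (y + e lam) μ - V y μ)‖ :=
          norm_add_le _ _
      _ ≤ g₂ * S + g₁ * G := by
          rw [norm_smul, norm_smul, Real.norm_eq_abs, Real.norm_eq_abs]
          exact add_le_add (mul_le_mul h2 (hS _ _) (norm_nonneg _) ((abs_nonneg _).trans h2))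
            (mul_le_mul (hg₁ y μ) (hG y lam μ) (norm_nonneg _) hg₁0)
  calc _ ≤ ∑ μ : Fin d, ‖(χ (x + e lam) - χ (x + e lam - e μ)) • V (x + e lam - e μ) μ - (χ x - χ (x - e μ)) • V (x - e μ) μ‖ := norm_sum_le _ _
    _ ≤ ∑ _μ : Fin d, (g₂ * S + g₁ * G) := sum_le_sum hterm
    _ = d * (g₂ * S + g₁ * G) := by rw [sum_const, card_univ, Fintype.card_fin, nsmul_eq_mul]

/-- **THE DIVERGENCE DATUM OF THE CUT-OFF FIELD**: if `flatDiv V = g + s` with `‖s‖ ≤ D` and `‖s(x+e_λ) − s(x)‖ ≤ D′`, then with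
`s_F x := χ x • s x + Σ_μ (χ x − χ(x−e_μ))•V(x−e_μ) μ` one has `flatDiv (χ•V) x = χ x • g x + s_F x` for all `x` and
`‖s_F(x+e_λ) − s_F(x)‖ ≤ g₁·D + D′ + d·(g₂·S + g₁·G)` (`|χ| ≤ 1`). [folklore] -/
theorem norm_fdiff_flatDiv_smul_le (χ : Site d → ℝ) (V : Site d → Fin d → Matrix n n ℂ) (g s : Site d → Matrix n n ℂ) {g₁ g₂ S G D D' : ℝ}
    (hχ1 : ∀ x, |χ x| ≤ 1) (hg₁ : ∀ (x : Site d) (i : Fin d), |χ (x + e i) - χ x| ≤ g₁)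
    (hg₂ : ∀ (x : Site d) (i j : Fin d), |χ (x + e i + e j) - χ (x + e i) - χ (x + e j) + χ x| ≤ g₂)
    (hS : ∀ x κ, ‖V x κ‖ ≤ S) (hG : ∀ (x : Site d) (lam κ : Fin d), ‖V (x + e lam) κ - V x κ‖ ≤ G)
    (hdiv : ∀ x, flatDiv V x = g x + s x) (hD : ∀ x, ‖s x‖ ≤ D) (hD' : ∀ (x : Site d) (lam : Fin d), ‖s (x + e lam) - s x‖ ≤ D')
    (x : Site d) (lam : Fin d) :
    flatDiv (fun w κ => χ w • V w κ) x = χ x • g x + (χ x • s x + ∑ μ : Fin d, (χ x - χ (x - e μ)) • V (x - e μ) μ) ∧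
    ‖(χ (x + e lam) • s (x + e lam) + ∑ μ : Fin d, (χ (x + e lam) - χ (x + e lam - e μ)) • V (x + e lam - e μ) μ)
        - (χ x • s x + ∑ μ : Fin d, (χ x - χ (x - e μ)) • V (x - e μ) μ)‖ ≤ g₁ * D + D' + d * (g₂ * S + g₁ * G) := by
  refine ⟨by rw [flatDiv_smul, hdiv, smul_add, add_assoc], ?_⟩
  have hg₁0 : 0 ≤ g₁ := (abs_nonneg _).trans (hg₁ x lam)
  have hR := norm_fdiff_flatDivRem_le χ V hg₁ hg₂ hS hG x lam
  have hs : ‖χ (x + e lam) • s (x + e lam) - χ x • s x‖ ≤ g₁ * D + D' := by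
    have e1 : χ (x + e lam) • s (x + e lam) - χ x • s x = (χ (x + e lam) - χ x) • s (x + e lam) + χ x • (s (x + e lam) - s x) := by
      simp only [sub_smul, smul_sub]; abel
    rw [e1]
    calc _ ≤ ‖(χ (x + e lam) - χ x) • s (x + e lam)‖ + ‖χ x • (s (x + e lam) - s x)‖ := norm_add_le _ _
      _ ≤ g₁ * D + 1 * D' := by
          rw [norm_smul, norm_smul, Real.norm_eq_abs, Real.norm_eq_abs]
          exact add_le_add (mul_le_mul (hg₁ x lam) (hD _) (norm_nonneg _) hg₁0) (mul_le_mul (hχ1 x) (hD' x lam) (norm_nonneg _) zero_le_one)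
      _ = g₁ * D + D' := by ring
  calc _ = ‖(χ (x + e lam) • s (x + e lam) - χ x • s x)
          + ((∑ μ : Fin d, (χ (x + e lam) - χ (x + e lam - e μ)) • V (x + e lam - e μ) μ) - ∑ μ : Fin d, (χ x - χ (x - e μ)) • V (x - e μ) μ)‖ := by
        congr 1; abel
    _ ≤ ‖χ (x + e lam) • s (x + e lam) - χ x • s x‖
          + ‖(∑ μ : Fin d, (χ (x + e lam) - χ (x + e lam - e μ)) • V (x + e lam - e μ) μ) - ∑ μ : Fin d, (χ x - χ (x - e μ)) • V (x - e μ) μ‖ := norm_add_le _ _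
    _ ≤ (g₁ * D + D') + d * (g₂ * S + g₁ * G) := add_le_add hs hR
    _ = g₁ * D + D' + d * (g₂ * S + g₁ * G) := by ring

end

end Summit.QuantumFields.BalabanUV.T4Continuum.NE7CutoffSecondOrderData
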